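import Literature.AlgebraicGeometry.HodgeTheory.WeilClassesBlochSeed
import Summits.HodgeConjecture.HodgeConjecture.Theses.EightfoldBlochSeeds

/-!
# Strengthen MEMO-04 erratum E4-1 made exact — seeds at DILATED hyperplane data witness the crux

The crux `BlochSeedDiscOne` is by definition `Literature.AlgebraicGeometry.HodgeTheory.HasHyperbolicBlochSeed 4 1`. Along the
isogeny tower `[α] : X → X` (`m = |α|²`; MEMO-03) the hyperplane class is multiplied by `m` (`[α]^* h = m·h`), and «upstairs» is the
SAME variety `X`. This file proves the one-line reason why the tower is «not moot» (R19.218 (iii)) and why, for CYCLES, it opens and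
closes no room (E4-1): a Bloch seed for the SCALED class `m · (d·H + ψ₀^*H)` (any rational `m ≠ 0`, same `X`, same `ψ₀`, any admissible
Weil class `w`) already gives `HasHyperbolicBlochSeed n d` — instantiate the ∃-bound hyperplane parameter at `m · a`
(`IsRationalClass.smul`, linearity of pull-back, `Motives.isHyperbolicWeilType_smul_iff`).

HONEST FRAMING: pure logic over the Literature definitions; no seed, SOURCE, monad or design is constructed; nothing toward HC, HC_CM,
HC_AV, №4∕26512 or 18881∕H2 is proved — the file only certifies that a witness at scale `m` would be a witness. No proof placeholders,
no new axioms (v1.1: + the crux BY NAME, identity probe, axiom guards — R19.230 light price).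
-/

namespace Summit.HodgeConjecture.HodgeConjecture.Cruxes.BlochSeedDiscOne.StrengthenScale

open CategoryTheory
open Literature.AlgebraicGeometry.HodgeTheory Literature.AlgebraicGeometry.Motives
open Literature.AlgebraicTopology.SingularHomology

universe u

variable {P : AbelianVariety ℂ} (ψ₀ : P ⟶ P) (d : ℕ) (e : ProjectiveEmbedding P.X)

/-- the symmetrised polarisation class `d·H + ψ₀^* H`, `H = e^* a`, exactly as it appears inline in `HasHyperbolicBlochSeed`. -/
noncomputable abbrev symClass (a : complexBetti (projectiveSpace e.n ℂ) 2) : complexBetti P.X 2 :=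
  (d : ℂ) • complexBetti.map e.ι 2 a + complexBetti.map ψ₀.hom.hom.hom 2 (complexBetti.map e.ι 2 a)

/-- the symmetrised class is `ℂ`-linear in the hyperplane parameter: `sym(c • a) = c • sym(a)`. -/
theorem symClass_smul (c : ℂ) (a : complexBetti (projectiveSpace e.n ℂ) 2) :
    symClass ψ₀ d e (c • a) = c • symClass ψ₀ d e a := by
  simp only [symClass, map_smul, smul_add, smul_comm (d : ℂ) c]

/-- **Seeds at dilated hyperplane data witness the crux.** If, on some `(P, ψ₀)` with `ψ₀² = −d`, a rational hyperplane parameter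
`a ≠ 0` makes `d·H + ψ₀^*H` of hyperbolic Weil type and an admissible Weil class `w` has a Bloch seed at the SCALED class
`m · (d·H + ψ₀^*H)` (`m ∈ ℚ`, `m ≠ 0`), then `HasHyperbolicBlochSeed n d` holds — with hyperplane parameter `m · a`. -/
theorem hasHyperbolicBlochSeed_of_scaled (n d : ℕ) (m : ℚ) (hm : m ≠ 0)
    (h : ∃ (P : AbelianVariety ℂ) (ψ₀ : P ⟶ P) (e : ProjectiveEmbedding P.X)
      (a : complexBetti (projectiveSpace e.n ℂ) 2) (w : complexBetti P.X (2 * n)),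
      P.dim = 2 * n ∧ ψ₀ ≫ ψ₀ = -(d • 𝟙 P) ∧ IsRationalClass a ∧ a ≠ 0 ∧
      IsHyperbolicWeilType P ψ₀ n (symClass ψ₀ d e a) ∧
      w ∈ weilClassesOf P ψ₀ n d ∧ IsRationalClass w ∧ w ≠ 0 ∧
      HasBlochSeedAt n P ((m : ℂ) • symClass ψ₀ d e a) w) :
    HasHyperbolicBlochSeed n d := by
  obtain ⟨P, ψ₀, e, a, w, hdim, hψ, ha, ha0, hhyp, hw, hwr, hw0, hseed⟩ := h
  have hm' : (m : ℂ) ≠ 0 := by exact_mod_cast hm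
  have hlin : symClass ψ₀ d e ((m : ℂ) • a) = (m : ℂ) • symClass ψ₀ d e a := symClass_smul ψ₀ d e (m : ℂ) a
  refine ⟨P, ψ₀, e, (m : ℂ) • a, w, hdim, hψ, ha.smul m, smul_ne_zero hm' ha0, ?_, hw, hwr, hw0, ?_⟩
  · show IsHyperbolicWeilType P ψ₀ n (symClass ψ₀ d e ((m : ℂ) • a))
    rw [hlin]
    exact (isHyperbolicWeilType_smul_iff hm').mpr hhyp
  · show HasBlochSeedAt n P (symClass ψ₀ d e ((m : ℂ) • a)) w
    rw [hlin]
    exact hseed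

/-- The same with the hyperbolicity hypothesis ALSO read at the scaled class (the fully «upstairs» datum `[α]^* h = m·h`): it is
equivalent to hyperbolicity at `h` (`isHyperbolicWeilType_smul_iff`), so nothing changes. -/
theorem hasHyperbolicBlochSeed_of_scaled' (n d : ℕ) (m : ℚ) (hm : m ≠ 0)
    (h : ∃ (P : AbelianVariety ℂ) (ψ₀ : P ⟶ P) (e : ProjectiveEmbedding P.X)
      (a : complexBetti (projectiveSpace e.n ℂ) 2) (w : complexBetti P.X (2 * n)),
      P.dim = 2 * n ∧ ψ₀ ≫ ψ₀ = -(d • 𝟙 P) ∧ IsRationalClass a ∧ a ≠ 0 ∧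
      IsHyperbolicWeilType P ψ₀ n ((m : ℂ) • symClass ψ₀ d e a) ∧
      w ∈ weilClassesOf P ψ₀ n d ∧ IsRationalClass w ∧ w ≠ 0 ∧
      HasBlochSeedAt n P ((m : ℂ) • symClass ψ₀ d e a) w) :
    HasHyperbolicBlochSeed n d := by
  obtain ⟨P, ψ₀, e, a, w, hdim, hψ, ha, ha0, hhyp, hw, hwr, hw0, hseed⟩ := h
  have hm' : (m : ℂ) ≠ 0 := by exact_mod_cast hm
  exact hasHyperbolicBlochSeed_of_scaled n d m hm
    ⟨P, ψ₀, e, a, w, hdim, hψ, ha, ha0, (isHyperbolicWeilType_smul_iff hm').mp hhyp, hw, hwr, hw0, hseed⟩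

/-- Specialisation to the crux's indices (`BlochSeedDiscOne := HasHyperbolicBlochSeed 4 1`): a seed at ANY scale `m` of the
`[1+i]`-tower (`m = 2^k`) or of any CM isogeny (`m = a² + b²`), indeed any rational `m ≠ 0`, decides the crux's defining statement. -/
theorem hasHyperbolicBlochSeed_four_one_of_scaled (m : ℚ) (hm : m ≠ 0)
    (h : ∃ (P : AbelianVariety ℂ) (ψ₀ : P ⟶ P) (e : ProjectiveEmbedding P.X)
      (a : complexBetti (projectiveSpace e.n ℂ) 2) (w : complexBetti P.X (2 * 4)),
      P.dim = 2 * 4 ∧ ψ₀ ≫ ψ₀ = -(1 • 𝟙 P) ∧ IsRationalClass a ∧ a ≠ 0 ∧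
      IsHyperbolicWeilType P ψ₀ 4 (symClass ψ₀ 1 e a) ∧
      w ∈ weilClassesOf P ψ₀ 4 1 ∧ IsRationalClass w ∧ w ≠ 0 ∧
      HasBlochSeedAt 4 P ((m : ℂ) • symClass ψ₀ 1 e a) w) :
    HasHyperbolicBlochSeed 4 1 :=
  hasHyperbolicBlochSeed_of_scaled 4 1 m hm h

/-! ## v1.1 — the crux BY NAME, identity probe, axiom guards (director R19.230 light price) -/

/-- identity probe: `symClass` IS the inline class of `HasHyperbolicBlochSeed` (definitional, `rfl`). -/
example (a : complexBetti (projectiveSpace e.n ℂ) 2) :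
    symClass ψ₀ d e a =
      (d : ℂ) • complexBetti.map e.ι 2 a + complexBetti.map ψ₀.hom.hom.hom 2 (complexBetti.map e.ι 2 a) := rfl

/-- the route's crux decl unfolds to the Literature predicate (`Iff.rfl`). -/
example : Summit.HodgeConjecture.HodgeConjecture.Theses.EightfoldBlochSeeds.BlochSeedDiscOne ↔
    HasHyperbolicBlochSeed 4 1 := Iff.rfl

/-- **The crux by name.** A Bloch seed at any rationally SCALED hyperplane datum decides `BlochSeedDiscOne`. -/
theorem blochSeedDiscOne_of_scaled (m : ℚ) (hm : m ≠ 0)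
    (h : ∃ (P : AbelianVariety ℂ) (ψ₀ : P ⟶ P) (e : ProjectiveEmbedding P.X)
      (a : complexBetti (projectiveSpace e.n ℂ) 2) (w : complexBetti P.X (2 * 4)),
      P.dim = 2 * 4 ∧ ψ₀ ≫ ψ₀ = -(1 • 𝟙 P) ∧ IsRationalClass a ∧ a ≠ 0 ∧
      IsHyperbolicWeilType P ψ₀ 4 (symClass ψ₀ 1 e a) ∧
      w ∈ weilClassesOf P ψ₀ 4 1 ∧ IsRationalClass w ∧ w ≠ 0 ∧
      HasBlochSeedAt 4 P ((m : ℂ) • symClass ψ₀ 1 e a) w) :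
    Summit.HodgeConjecture.HodgeConjecture.Theses.EightfoldBlochSeeds.BlochSeedDiscOne :=
  hasHyperbolicBlochSeed_of_scaled 4 1 m hm h

/--
info: 'Summit.HodgeConjecture.HodgeConjecture.Cruxes.BlochSeedDiscOne.StrengthenScale.hasHyperbolicBlochSeed_of_scaled' depends on axioms: [propext,
 Classical.choice,
 Quot.sound]
-/
#guard_msgs in #print axioms hasHyperbolicBlochSeed_of_scaled

/--
info: 'Summit.HodgeConjecture.HodgeConjecture.Cruxes.BlochSeedDiscOne.StrengthenScale.blochSeedDiscOne_of_scaled' depends on axioms: [propext,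
 Classical.choice,
 Quot.sound]
-/
#guard_msgs in #print axioms blochSeedDiscOne_of_scaled

end Summit.HodgeConjecture.HodgeConjecture.Cruxes.BlochSeedDiscOne.StrengthenScale
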